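import Summits.QuantumFields.BalabanUV.Beta.CombHId2TorusTwin

/-!
# `BalabanUV.Beta.CombHId2TorusTwinSlots` — binder row D1 (OWNER an2), (J-a) dictionary, (C2) at ORDER 2, PART THREE (letters, 2d-bis): **THE SLOT WORDS OF `Ŵ` HAVE NO
# MULTIPLIER–MULTIPLIER BLOCK AND AN ANTISYMMETRIC-TWIN BORDER AT an1's RECORD** — leaf-05's J2-record v2 sockets `hWmm` ∕ `hWfm` for `Ŵ^{slots}` (W-11 l.51707)

WHY.  By W-an2-g45-9 ∕ leaf-05 W-11 the door books an2's second-order word as `Ŵ = Ŵ^{slots} + Ẑ^{sym}`: the response word `Ẑ` is border-SYMMETRIC (letters 2d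
`CombHId2TorusTwin` §4), the slot words `Ŵ^{slots}_{bb′} := vertex2OfK G Lc T2^{per,csf}_j b b′ + mixOfK G Lc M2^{per,cs}_j b b′ + mixOfK G Lc M2^{per,cs}_j b′ b` are border-ANTI.
This file types the latter at an1's record `tabs := symTablesAn1S2 d Lc cΛ′` (generic `d`), from the record's packers BY NAME: the `T2` tables are `cE₂ • wilsonW₂ + cB • vh₂S` at
level 0 and `(cE₂·wV4) • e4OfKW … + (cB·wB2) • vh₂S` above (`RecursiveWSlot.T2RecOf`), with `wilsonW₂` and the `mmRead`-placed `e4OfKW` field-block-only (an3's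
`WilsonBiStencil.wilsonW₂_inl_inr ∕ _inr_inl ∕ _inr_inr`, `BalabanStepJetsSucc.mmRead_inr_left ∕ _right`) and `vh₂S = symVh₂SAn1` ANTI-twin on the border with no `mm` block
(an1's `SymSecondOrderTablesAn1.symTablesAn1S2_vh₂S_antiTwin`, `symVh₂SAn1_inr_inr`); the mixed tables `M2Of mixFF j = wM2 j • symMixFFAt …` are field-block-only (an1's
`symTablesAn1S2_mixFF_inr ∕ _inl_inr`, W-an1-g82-1 (a)).  The copy sums and `dper` preserve both properties termwise, and `vertexOfK K′` ∕ `vertexOfM K′` weight the tables by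
SCALARS (any weight kernel).  The split `Ŵ = (slots) + (response)` itself is `CombHId2TorusRecord.perF_W2SymOfK_comb` + `perF_W2OfK_comb` (in the tree).
WHAT ([folklore]; 0 `def`, 0 cited fact, 0 `def … : Prop`, 0 sorry): §1 generic (ANY weight kernel): `dper_antitwin_of_antitwin`, `vertexOfK_entry_eq_zero_of_tables`,
`vertexOfK_antitwin_of_tables`, `vertexOfK_translate_inv_of_tables`, `vertexOfM_entry_eq_zero_of_tables`, `vertexOfM_translate_inv_of_tables`; §2 record tables:
`e4OfKW_inr_left ∕ _inr_right`, `T2comb_an1_inr_inr`, `T2comb_an1_antitwin`, `T2csf_an1_inr_inr`, `T2csf_an1_antitwin`, `M2cs_an1_left_inr`, `M2cs_an1_right_inr`; §3 the words: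
**`perF_vertex2OfK_comb_an1_inr_inr`**, **`perF_vertex2OfK_comb_an1_antitwin`**, **`perF_mixOfK_comb_an1_inr_left`**, **`perF_mixOfK_comb_an1_inr_right`** — hence (L1b)
`Ŵ^{slots}∘(fμ,fμ) = 0` and (L2b-slots) `Ŵ^{slots}∘(f,fμ) = −(Ŵ^{slots}∘(fμ,f))ᵀ` entrywise, for both orders of the bond pair (the `mixOfK` words have NO border at all).
NOT HERE: the field-block symmetry of `Ŵ^{slots}` (`H₂ᵀ = H₂`: an3's `wilsonW₂_symTab_transpose` ∕ my `torus_H2_transpose`, not a J2 socket); the torus algebra (leaf-05);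
nothing of Bałaban's asserted; NOT D1, NEVER «G-an2-4 closed», NOT BetaPertH, NOT continuum, NOT Clay.

HONEST DEPENDENCY (page 1, mandatory): continuum YM on T⁴ ⇐ BetaPertH ∧ nine spine estimates (0/9 proved); BetaPertH ⇐ (D1) ∧ (D4) ∧ CAP+tail;
G-an2-4 gates asym, D1 and NE2/3/4.  HONEST FRAMING (cell contract, verbatim): «discharging `BetaPertH` makes Bałaban's UV stability UNCONDITIONAL —
a real constructive-QFT result; it is NOT the continuum limit and NOT the Clay problem.»  ABSOLUTE RULE (cell charter, verbatim): «No internally-minted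
statement may enter as a cited fact. Every hypothesis is either kernel-proved in this package or a verbatim quotation of a PUBLISHED theorem with page
reference. The manuscript(s) under audit are NOT citable for their own disputed steps — they are the thing under adjudication; programme-internal
(2001/route/tribunal) claims are never citable.»  Row D1 OWNER an2 (b2b-balaban-beta-an2) gen 45, 2026-08-23; over `CombHId2TorusTwin` and the record's packers BY NAME.
-/

noncomputable section

open scoped BigOperators Matrix

namespace Summit.QuantumFields.BalabanUV.Beta.CombHId2TorusTwinSlots

open Literature.MathematicalPhysics.QuantumFieldTheory.Balaban1983to89
open Literature.MathematicalPhysics.QuantumFieldTheory.Balaban1983to89.Beta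
open B4TorusKernel.MultiPeriod (translate)
open ExpKernelCalculus (MKer)
open AffineAveraging (Site)
open OneStepResolventKernel (Fib)
open SecondOrderResponse (vertexOfM vertex2OfK mixOfK W2SymOfK)
open OneStepKernelFamily (vertexOfK)
open BalabanStepW2 (M2Of)
open WilsonBiStencil (wilsonW₂ wilsonW₂_inl_inr wilsonW₂_inr_inl wilsonW₂_inr_inr)
open BalabanStepJetsSucc (mmRead mmRead_inr_left mmRead_inr_right)
open InterLevelTransport (cwsum_apply)
open Summit.QuantumFields.BalabanUV.Beta.SpineRooted (T2RecOf T2RecOf_zero_level T2RecOf_succ WrecOf e4OfKW)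
open Summit.QuantumFields.BalabanUV.Beta.FP.KernelPeriodisationFib (perF perZ perF_apply perZ_apply)
open Summit.QuantumFields.BalabanUV.Beta.FP.KernelPeriodisationFibLoc (dper dper_apply dper_translate)
open Summit.QuantumFields.BalabanUV.Beta.SymSecondOrderTablesAn1 (symTablesAn1S2 symTablesAn1S2_vh₂S symVh₂SAn1_inr_inr symTablesAn1S2_vh₂S_antiTwin
  symTablesAn1S2_mixFF_inr symTablesAn1S2_mixFF_inl_inr)
open Summit.QuantumFields.BalabanUV.Beta.CombChartStepJets (GcombSh SpureCombOf)
open B6Lemma24Torus (pbox)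
open Summit.QuantumFields.BalabanUV.Beta.CombHId1Letters (vertexOfK_apply)
open Summit.QuantumFields.BalabanUV.Beta.CombHId2TorusTwin (perF_eq_zero_of_entries perF_antitwin_of_antitwin dper_entry_eq_zero)

variable {d : ℕ} (M : Fin (d + 1) → ℕ) [∀ μ, NeZero (M μ)]

/-! ## §1 Generic letters: vanishing blocks, anti-twin symmetry and period invariance pass through `dper`, `vertexOfK K′`, `vertexOfM K′` (any weight kernel) -/

omit [∀ μ, NeZero (M μ)] in
/-- [folklore] `dper` preserves anti-twin symmetry. -/
theorem dper_antitwin_of_antitwin {X : MKer (d + 1) (Fib d)} {a b : Fib d} (h : ∀ x z : Site (d + 1), X x z a b = -X z x b a) (x z : Site (d + 1)) :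
    dper M X x z a b = -dper M X z x b a := by
  simp only [dper_apply]
  rw [← tsum_neg]
  exact tsum_congr fun n => h _ _

/-- [folklore] a field vertex over tables with a vanishing block has that block vanishing (any weight kernel). -/
theorem vertexOfK_entry_eq_zero_of_tables (K' : MKer (d + 1) (Fib d)) (N : ℕ) {S : Fin (d + 1) → Site (d + 1) → MKer (d + 1) (Fib d)} {a b : Fib d}
    (hS : ∀ (κ : Fin (d + 1)) (u x z : Site (d + 1)), S κ u x z a b = 0) (μ : Fin (d + 1)) (y x z : Site (d + 1)) :
    vertexOfK K' N S μ y x z a b = 0 := by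
  simp only [vertexOfK_apply, hS, mul_zero, tsum_zero, Finset.sum_const_zero]

/-- [folklore] a field vertex over anti-twin tables is anti-twin (any weight kernel). -/
theorem vertexOfK_antitwin_of_tables (K' : MKer (d + 1) (Fib d)) (N : ℕ) {S : Fin (d + 1) → Site (d + 1) → MKer (d + 1) (Fib d)} {a b : Fib d}
    (hS : ∀ (κ : Fin (d + 1)) (u x z : Site (d + 1)), S κ u x z a b = -S κ u z x b a) (μ : Fin (d + 1)) (y x z : Site (d + 1)) :
    vertexOfK K' N S μ y x z a b = -vertexOfK K' N S μ y z x b a := by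
  rw [vertexOfK_apply, vertexOfK_apply]
  simp only [hS, mul_neg, tsum_neg, Finset.sum_neg_distrib]

omit [∀ μ, NeZero (M μ)] in
/-- [folklore] a field vertex over period-invariant tables is period invariant (any weight kernel). -/
theorem vertexOfK_translate_inv_of_tables (K' : MKer (d + 1) (Fib d)) (N : ℕ) {S : Fin (d + 1) → Site (d + 1) → MKer (d + 1) (Fib d)}
    (hS : ∀ (κ : Fin (d + 1)) (u m x z : Site (d + 1)) (a b : Fib d), S κ u (translate M x m) (translate M z m) a b = S κ u x z a b)
    (μ : Fin (d + 1)) (y m x z : Site (d + 1)) (a b : Fib d) :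
    vertexOfK K' N S μ y (translate M x m) (translate M z m) a b = vertexOfK K' N S μ y x z a b := by
  rw [vertexOfK_apply, vertexOfK_apply]
  simp only [hS]

/-- [folklore] a multiplier vertex over tables with a vanishing block has that block vanishing (any weight kernel). -/
theorem vertexOfM_entry_eq_zero_of_tables (K' : MKer (d + 1) (Fib d)) (N : ℕ) [NeZero N] {Mt : Fin (d + 1) → Site (d + 1) → MKer (d + 1) (Fib d)} {a b : Fib d}
    (hMt : ∀ (ρ : Fin (d + 1)) (w x z : Site (d + 1)), Mt ρ w x z a b = 0) (μ : Fin (d + 1)) (y x z : Site (d + 1)) :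
    vertexOfM K' N Mt μ y x z a b = 0 := by
  unfold SecondOrderResponse.vertexOfM
  simp only [cwsum_apply, hMt, mul_zero, tsum_zero, Finset.sum_const_zero]

omit [∀ μ, NeZero (M μ)] in
/-- [folklore] a multiplier vertex over period-invariant tables is period invariant (any weight kernel). -/
theorem vertexOfM_translate_inv_of_tables (K' : MKer (d + 1) (Fib d)) (N : ℕ) [NeZero N] {Mt : Fin (d + 1) → Site (d + 1) → MKer (d + 1) (Fib d)}
    (hMt : ∀ (ρ : Fin (d + 1)) (w m x z : Site (d + 1)) (a b : Fib d), Mt ρ w (translate M x m) (translate M z m) a b = Mt ρ w x z a b)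
    (μ : Fin (d + 1)) (y m x z : Site (d + 1)) (a b : Fib d) :
    vertexOfM K' N Mt μ y (translate M x m) (translate M z m) a b = vertexOfM K' N Mt μ y x z a b := by
  unfold SecondOrderResponse.vertexOfM
  simp only [cwsum_apply, hMt]

/-! ## §2 At an1's record: the second-order tables' blocks -/

section Record

variable {Lc : ℕ} [NeZero Lc] {M' : Fin (d + 1) → ℕ} (cΛ' cE cVH cΛ cE₂ cB : ℝ) (T : Fin 4 → Fin 4 → Fin 4 → Fin 4 → ℝ)

omit [∀ μ, NeZero (M μ)] [NeZero Lc] in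
/-- [folklore] the `mmRead`-placed chain part `e4OfKW` has no entry with a multiplier leg on the left … -/
theorem e4OfKW_inr_left (K : MKer (d + 1) (Fib d)) (S Mt : Fin (d + 1) → Site (d + 1) → MKer (d + 1) (Fib d))
    (W : Fin (d + 1) → Site (d + 1) → Fin (d + 1) → Site (d + 1) → MKer (d + 1) (Fib d)) (μ : Fin (d + 1)) (y : Site (d + 1)) (ν : Fin (d + 1))
    (y' x z : Site (d + 1)) (m : Fin (d + 1)) (b : Fib d) : e4OfKW Lc K S Mt W μ y ν y' x z (Sum.inr m) b = 0 := by
  unfold SpineRooted.e4OfKW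
  exact mmRead_inr_left Lc _ x z m b

omit [∀ μ, NeZero (M μ)] [NeZero Lc] in
/-- [folklore] … nor on the right. -/
theorem e4OfKW_inr_right (K : MKer (d + 1) (Fib d)) (S Mt : Fin (d + 1) → Site (d + 1) → MKer (d + 1) (Fib d))
    (W : Fin (d + 1) → Site (d + 1) → Fin (d + 1) → Site (d + 1) → MKer (d + 1) (Fib d)) (μ : Fin (d + 1)) (y : Site (d + 1)) (ν : Fin (d + 1))
    (y' x z : Site (d + 1)) (a : Fib d) (m : Fin (d + 1)) : e4OfKW Lc K S Mt W μ y ν y' x z a (Sum.inr m) = 0 := by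
  unfold SpineRooted.e4OfKW
  exact mmRead_inr_right Lc _ x z a m

omit [∀ μ, NeZero (M μ)] in
/-- [folklore] **at an1's record the level-`j` second-order field table has no multiplier–multiplier block** (every level). -/
theorem T2comb_an1_inr_inr (j : ℕ) (κ : Fin (d + 1)) (u : Site (d + 1)) (κ' : Fin (d + 1)) (u' x z : Site (d + 1)) (m m' : Fin (d + 1)) :
    T2RecOf d Lc (GcombSh Lc) (SpureCombOf (symTablesAn1S2 d Lc cΛ') cE cVH cΛ) (symTablesAn1S2 d Lc cΛ').M cE₂ cB T (symTablesAn1S2 d Lc cΛ').vh₂S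
        (symTablesAn1S2 d Lc cΛ').mixFF j κ u κ' u' x z (Sum.inr m) (Sum.inr m') = 0 := by
  cases j with
  | zero =>
    rw [T2RecOf_zero_level]
    simp only [Pi.add_apply, Pi.smul_apply, smul_eq_mul, wilsonW₂_inr_inr, symTablesAn1S2_vh₂S, symVh₂SAn1_inr_inr, mul_zero, add_zero]
  | succ j =>
    rw [T2RecOf_succ]
    simp only [Pi.add_apply, Pi.smul_apply, smul_eq_mul, e4OfKW_inr_left, symTablesAn1S2_vh₂S, symVh₂SAn1_inr_inr, mul_zero, add_zero]

omit [∀ μ, NeZero (M μ)] in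
/-- [folklore] **… and an ANTISYMMETRIC-twin border** (the Wilson and chain sectors have no border; `vh₂S = symVh₂SAn1` is `atw`-packed — an1's `symTablesAn1S2_vh₂S_antiTwin`). -/
theorem T2comb_an1_antitwin (j : ℕ) (κ : Fin (d + 1)) (u : Site (d + 1)) (κ' : Fin (d + 1)) (u' x z : Site (d + 1)) (α m : Fin (d + 1)) :
    T2RecOf d Lc (GcombSh Lc) (SpureCombOf (symTablesAn1S2 d Lc cΛ') cE cVH cΛ) (symTablesAn1S2 d Lc cΛ').M cE₂ cB T (symTablesAn1S2 d Lc cΛ').vh₂S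
        (symTablesAn1S2 d Lc cΛ').mixFF j κ u κ' u' x z (Sum.inr m) (Sum.inl α)
      = -T2RecOf d Lc (GcombSh Lc) (SpureCombOf (symTablesAn1S2 d Lc cΛ') cE cVH cΛ) (symTablesAn1S2 d Lc cΛ').M cE₂ cB T (symTablesAn1S2 d Lc cΛ').vh₂S
        (symTablesAn1S2 d Lc cΛ').mixFF j κ u κ' u' z x (Sum.inl α) (Sum.inr m) := by
  cases j with
  | zero =>
    rw [T2RecOf_zero_level]
    simp only [Pi.add_apply, Pi.smul_apply, smul_eq_mul, wilsonW₂_inr_inl, wilsonW₂_inl_inr, mul_zero, zero_add]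
    rw [symTablesAn1S2_vh₂S_antiTwin]
    ring
  | succ j =>
    rw [T2RecOf_succ]
    simp only [Pi.add_apply, Pi.smul_apply, smul_eq_mul, e4OfKW_inr_left, e4OfKW_inr_right, mul_zero, zero_add]
    rw [symTablesAn1S2_vh₂S_antiTwin]
    ring

omit [∀ μ, NeZero (M μ)] in
/-- [folklore] the record-shape slot `T2^{per,csf}_j κ u κ′ u′ := dper M (Σ'_n T2_j κ u κ′ (u′+M∘n))` has no multiplier–multiplier block … -/
theorem T2csf_an1_inr_inr (j : ℕ) (κ : Fin (d + 1)) (u : Site (d + 1)) (κ' : Fin (d + 1)) (u' x z : Site (d + 1)) (m m' : Fin (d + 1)) :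
    dper M (fun x z a c => ∑' n : Site (d + 1), T2RecOf d Lc (GcombSh Lc) (SpureCombOf (symTablesAn1S2 d Lc cΛ') cE cVH cΛ) (symTablesAn1S2 d Lc cΛ').M cE₂ cB T
        (symTablesAn1S2 d Lc cΛ').vh₂S (symTablesAn1S2 d Lc cΛ').mixFF j κ u κ' (translate M u' n) x z a c) x z (Sum.inr m) (Sum.inr m') = 0 :=
  dper_entry_eq_zero M (fun x z => by simp only [T2comb_an1_inr_inr, tsum_zero]) x z

omit [∀ μ, NeZero (M μ)] in
/-- [folklore] … and an antisymmetric-twin border. -/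
theorem T2csf_an1_antitwin (j : ℕ) (κ : Fin (d + 1)) (u : Site (d + 1)) (κ' : Fin (d + 1)) (u' x z : Site (d + 1)) (α m : Fin (d + 1)) :
    dper M (fun x z a c => ∑' n : Site (d + 1), T2RecOf d Lc (GcombSh Lc) (SpureCombOf (symTablesAn1S2 d Lc cΛ') cE cVH cΛ) (symTablesAn1S2 d Lc cΛ').M cE₂ cB T
        (symTablesAn1S2 d Lc cΛ').vh₂S (symTablesAn1S2 d Lc cΛ').mixFF j κ u κ' (translate M u' n) x z a c) x z (Sum.inr m) (Sum.inl α)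
      = -dper M (fun x z a c => ∑' n : Site (d + 1), T2RecOf d Lc (GcombSh Lc) (SpureCombOf (symTablesAn1S2 d Lc cΛ') cE cVH cΛ) (symTablesAn1S2 d Lc cΛ').M cE₂ cB T
        (symTablesAn1S2 d Lc cΛ').vh₂S (symTablesAn1S2 d Lc cΛ').mixFF j κ u κ' (translate M u' n) x z a c) z x (Sum.inl α) (Sum.inr m) :=
  dper_antitwin_of_antitwin M (fun x z => by
    simp only [T2comb_an1_antitwin cΛ' cE cVH cΛ cE₂ cB T j κ u κ' _ x z α m, tsum_neg]) x z

omit [∀ μ, NeZero (M μ)] in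
/-- [folklore] the record-shape mixed slot `M2^{per,cs}_j κ u ρ w := dper M (Σ'_n M2Of mixFF j κ u ρ (w+M′∘n))` has no entry with a multiplier leg on the left … -/
theorem M2cs_an1_left_inr (j : ℕ) (κ : Fin (d + 1)) (u : Site (d + 1)) (ρ : Fin (d + 1)) (w x z : Site (d + 1)) (m : Fin (d + 1)) (b : Fib d) :
    dper M (fun x z a c => ∑' n : Site (d + 1), M2Of d Lc (symTablesAn1S2 d Lc cΛ').mixFF j κ u ρ (translate M' w n) x z a c) x z (Sum.inr m) b = 0 :=
  dper_entry_eq_zero M (fun x z => by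
    simp only [BalabanStepW2.M2Of, Pi.smul_apply, smul_eq_mul, symTablesAn1S2_mixFF_inr, mul_zero, tsum_zero]) x z

omit [∀ μ, NeZero (M μ)] in
/-- [folklore] … nor on the right (an1's `symMixFFAt` is field-block-only). -/
theorem M2cs_an1_right_inr (j : ℕ) (κ : Fin (d + 1)) (u : Site (d + 1)) (ρ : Fin (d + 1)) (w x z : Site (d + 1)) (a : Fib d) (m : Fin (d + 1)) :
    dper M (fun x z a c => ∑' n : Site (d + 1), M2Of d Lc (symTablesAn1S2 d Lc cΛ').mixFF j κ u ρ (translate M' w n) x z a c) x z a (Sum.inr m) = 0 :=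
  dper_entry_eq_zero M (fun x z => by
    cases a <;>
      simp only [BalabanStepW2.M2Of, Pi.smul_apply, smul_eq_mul, symTablesAn1S2_mixFF_inr, symTablesAn1S2_mixFF_inl_inr, mul_zero, tsum_zero]) x z

/-! ## §3 The slot words at an1's record: (L1b) no `mm` block, (L2b-slots) antisymmetric-twin border; the mixed words have no border at all -/

omit [∀ μ, NeZero (M μ)] in
/-- [folklore] **(L1b-i) the record's bi-vertex word over `T2^{per,csf}_j` has no multiplier–multiplier block** (any bond pair). -/
theorem perF_vertex2OfK_comb_an1_inr_inr (j : ℕ) (μ : Fin (d + 1)) (y : Site (d + 1)) (ν : Fin (d + 1)) (y' : Site (d + 1)) (xbar zbar : ↥(pbox M))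
    (m m' : Fin (d + 1)) :
    perF M (vertex2OfK (GcombSh (d := d) Lc j) Lc (fun κ u κ' u' => dper M (fun x z a c => ∑' n : Site (d + 1),
        T2RecOf d Lc (GcombSh Lc) (SpureCombOf (symTablesAn1S2 d Lc cΛ') cE cVH cΛ) (symTablesAn1S2 d Lc cΛ').M cE₂ cB T (symTablesAn1S2 d Lc cΛ').vh₂S
          (symTablesAn1S2 d Lc cΛ').mixFF j κ u κ' (translate M u' n) x z a c)) μ y ν y') (xbar, Sum.inr m) (zbar, Sum.inr m') = 0 :=
  perF_eq_zero_of_entries M (fun x z => vertexOfK_entry_eq_zero_of_tables _ _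
    (fun κ u x z => vertexOfK_entry_eq_zero_of_tables _ _ (fun κ' u' x z => T2csf_an1_inr_inr M cΛ' cE cVH cΛ cE₂ cB T j κ u κ' u' x z m m') ν y' x z) μ y x z)
    xbar zbar

omit [∀ μ, NeZero (M μ)] in
/-- [folklore] **(L2b-i) the record's bi-vertex word over `T2^{per,csf}_j` has an ANTISYMMETRIC-twin border**:
`V̂₂((x̄, inr m),(z̄, inl α)) = −V̂₂((z̄, inl α),(x̄, inr m))`, `V̂₂ := perF M (vertex2OfK (GcombSh Lc j) Lc T2^{per,csf}_j μ y ν y′)`. -/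
theorem perF_vertex2OfK_comb_an1_antitwin (j : ℕ) (μ : Fin (d + 1)) (y : Site (d + 1)) (ν : Fin (d + 1)) (y' : Site (d + 1)) (xbar zbar : ↥(pbox M))
    (α m : Fin (d + 1)) :
    perF M (vertex2OfK (GcombSh (d := d) Lc j) Lc (fun κ u κ' u' => dper M (fun x z a c => ∑' n : Site (d + 1),
        T2RecOf d Lc (GcombSh Lc) (SpureCombOf (symTablesAn1S2 d Lc cΛ') cE cVH cΛ) (symTablesAn1S2 d Lc cΛ').M cE₂ cB T (symTablesAn1S2 d Lc cΛ').vh₂S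
          (symTablesAn1S2 d Lc cΛ').mixFF j κ u κ' (translate M u' n) x z a c)) μ y ν y') (xbar, Sum.inr m) (zbar, Sum.inl α)
      = -perF M (vertex2OfK (GcombSh (d := d) Lc j) Lc (fun κ u κ' u' => dper M (fun x z a c => ∑' n : Site (d + 1),
        T2RecOf d Lc (GcombSh Lc) (SpureCombOf (symTablesAn1S2 d Lc cΛ') cE cVH cΛ) (symTablesAn1S2 d Lc cΛ').M cE₂ cB T (symTablesAn1S2 d Lc cΛ').vh₂S
          (symTablesAn1S2 d Lc cΛ').mixFF j κ u κ' (translate M u' n) x z a c)) μ y ν y') (zbar, Sum.inl α) (xbar, Sum.inr m) := by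
  have hXinv : ∀ (n x z : Site (d + 1)) (a b : Fib d),
      vertex2OfK (GcombSh (d := d) Lc j) Lc (fun κ u κ' u' => dper M (fun x z a c => ∑' n : Site (d + 1),
        T2RecOf d Lc (GcombSh Lc) (SpureCombOf (symTablesAn1S2 d Lc cΛ') cE cVH cΛ) (symTablesAn1S2 d Lc cΛ').M cE₂ cB T (symTablesAn1S2 d Lc cΛ').vh₂S
          (symTablesAn1S2 d Lc cΛ').mixFF j κ u κ' (translate M u' n) x z a c)) μ y ν y' (translate M x n) (translate M z n) a b
        = vertex2OfK (GcombSh (d := d) Lc j) Lc (fun κ u κ' u' => dper M (fun x z a c => ∑' n : Site (d + 1),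
        T2RecOf d Lc (GcombSh Lc) (SpureCombOf (symTablesAn1S2 d Lc cΛ') cE cVH cΛ) (symTablesAn1S2 d Lc cΛ').M cE₂ cB T (symTablesAn1S2 d Lc cΛ').vh₂S
          (symTablesAn1S2 d Lc cΛ').mixFF j κ u κ' (translate M u' n) x z a c)) μ y ν y' x z a b :=
    fun n x z a b => vertexOfK_translate_inv_of_tables M _ _
      (fun κ u n x z a b => vertexOfK_translate_inv_of_tables M _ _ (fun κ' u' n x z a b => dper_translate M _ n x z a b) ν y' n x z a b) μ y n x z a b
  refine perF_antitwin_of_antitwin M hXinv (fun x z => ?_) xbar zbar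
  exact vertexOfK_antitwin_of_tables _ _
    (fun κ u x z => vertexOfK_antitwin_of_tables _ _ (fun κ' u' x z => T2csf_an1_antitwin M cΛ' cE cVH cΛ cE₂ cB T j κ u κ' u' x z α m) ν y' x z) μ y x z

omit [∀ μ, NeZero (M μ)] in
/-- [folklore] **the record's mixed bi-vertex word over `M2^{per,cs}_j` has no entry with a multiplier leg on the left** — so no `mm` block and no `(fμ, f)` border (any bond pair,
either order). -/
theorem perF_mixOfK_comb_an1_inr_left (j : ℕ) (μ : Fin (d + 1)) (y : Site (d + 1)) (ν : Fin (d + 1)) (y' : Site (d + 1)) (xbar zbar : ↥(pbox M))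
    (m : Fin (d + 1)) (b : Fib d) :
    perF M (mixOfK (GcombSh (d := d) Lc j) Lc
        (fun κ u ρ w => dper M (fun x z a c => ∑' n : Site (d + 1), M2Of d Lc (symTablesAn1S2 d Lc cΛ').mixFF j κ u ρ (translate M' w n) x z a c)) μ y ν y')
      (xbar, Sum.inr m) (zbar, b) = 0 :=
  perF_eq_zero_of_entries M (fun x z => vertexOfK_entry_eq_zero_of_tables _ _
    (fun κ u x z => vertexOfM_entry_eq_zero_of_tables _ _ (fun ρ w x z => M2cs_an1_left_inr M cΛ' j κ u ρ w x z m b) ν y' x z) μ y x z) xbar zbar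

omit [∀ μ, NeZero (M μ)] in
/-- [folklore] **… and none with a multiplier leg on the right** — so no `(f, fμ)` border either: the mixed words contribute NOTHING to J2's border sockets. -/
theorem perF_mixOfK_comb_an1_inr_right (j : ℕ) (μ : Fin (d + 1)) (y : Site (d + 1)) (ν : Fin (d + 1)) (y' : Site (d + 1)) (xbar zbar : ↥(pbox M))
    (a : Fib d) (m : Fin (d + 1)) :
    perF M (mixOfK (GcombSh (d := d) Lc j) Lc
        (fun κ u ρ w => dper M (fun x z a c => ∑' n : Site (d + 1), M2Of d Lc (symTablesAn1S2 d Lc cΛ').mixFF j κ u ρ (translate M' w n) x z a c)) μ y ν y')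
      (xbar, a) (zbar, Sum.inr m) = 0 :=
  perF_eq_zero_of_entries M (fun x z => vertexOfK_entry_eq_zero_of_tables _ _
    (fun κ u x z => vertexOfM_entry_eq_zero_of_tables _ _ (fun ρ w x z => M2cs_an1_right_inr M cΛ' j κ u ρ w x z a m) ν y' x z) μ y x z) xbar zbar

end Record

end Summit.QuantumFields.BalabanUV.Beta.CombHId2TorusTwinSlots

end
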